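import Summits.ResolutionOfSingularities.ResolutionOfSingularities.Theorems.MarkedTransferCampaignW24ReducedBridgePIff
import HarnessLib

/-!
# The LEVEL-`q` bridge at an ARBITRARY PRIME `p`, part 7: the twin-carrier equivalence at BOTTOM DIGIT `1` (HIRONAKA-L · cell `res-hironaka` ·
# slot W2.4 «bottom-member re-run»; companion of `…ReducedBridgePIff.lean`, which treats bottom digit `≥ 2`)

**HONEST FRAMING.** OURS throughout: kernel theorems connecting OURS objects of the cell (res-L1-k24's `CampaignW24.ReducedRun`, res-type-059's
`CampaignW24.StaysInBox`, res-D-pv-020's `CampaignW24.ReducedBridge(P)`). Nothing below is a statement of H. Hironaka's manuscript [Hironaka2017]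
(lit key `paper:url-3343fd9e678b`), nothing asserts that any statement of it holds, nothing is a claim about resolution of singularities in
characteristic `p`; the manuscript stays «under review» (D-0012/D-0089). AI work, weaker than expert review. Written by res-D-pv-020 (W2.4 lineage).

## What is proved (`K` of characteristic `p` with the premise binders; `0 < e`; `q = p^e`; `0 < r₀ < q`, `p ∤ r₀`; `ord G₀ = 1`, `G₀` finitely
## supported with bound `B`; `k̄ = q / r₀ + 1`, `G₁ := univStepIIIq k̄ G₀` — the state after the forced Case-(III) first step at every depth `> B`)
* `run_of_level_of_escape_digitOneP`, `not_staysInBox_of_escape_digitOneP`, `not_carrierStaysInBox_of_escapes_digitOneP`: escapes of the run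
  of `G₁` at every large `p`-power depth refute the premise for `Φ_{q,r₀} G₀`.
* **`carrierStaysInBox_phiQ_iff_digitOne`**: `Rescue.CarrierStaysInBox p e (Φ_{q,r₀} G₀) ↔` the canonical reduced run of `G₁` is EXHAUSTED IN BOX
  at infinitely many `p`-power depths. With `…PIff` (digit `≥ 2`) this characterises the OURS premise on EVERY one-variable twin carrier
  `x^{r₀}·G₀(x^q)` with `q < ord`, at every prime, by the reduced model alone.
Hypotheses: each theorem's own binders; no FACT-LIST fact, no DEFECT binder. Standard axioms only.
-/

noncomputable section

set_option linter.dupNamespace false -- mandated namespace of this single-conjunct summit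

namespace Summit.ResolutionOfSingularities.ResolutionOfSingularities.Theorems

namespace CampaignW24

namespace ReducedBridgeP

open Literature.AlgebraicGeometry.Hironaka2017.S08UnitMonomial (StandardExpression nonempty_standardExpression_topFrame)
open Literature.AlgebraicGeometry.Hironaka2017.S09LLUED
open Literature.AlgebraicGeometry.Hironaka2017.S09LLUED.TopFrontier
open Literature.AlgebraicGeometry.Hironaka2017.S09LLUED.TopDeriv
open Literature.AlgebraicGeometry.Resolution (adicOrder)
open Literature.RingTheory.MvPowerSeries (adicOrder_eq_order)
open CampaignW21 (xs hasseD)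
open ReducedBridge

variable {K : Type} [Field K] {p : ℕ} [hp : Fact p.Prime] [CharP K p]

/-! ## §1 Escapes after the Case-(III) first step -/

/-- **Run bridge at bottom digit `1` under an ESCAPE of the second state's run** (depth `p^{ℓ−e}`, `k̄ = q / r₀ + 1`): every legal depth-`ℓ` run
from `F₀ = Φ_{q,r₀} G₀ + R₀` has length `≤ i₁ + 1` and is `Φ_{q,r₀}(canonRun … (canonStepIIIq … k̄ G₀) (i−1)) + passenger` from state `1` on.
[folklore] -/
theorem run_of_level_of_escape_digitOneP {e ℓ : ℕ} (he : 0 < e) (hle : e ≤ ℓ) {r₀ : ℕ} (hr₀ : r₀ < p ^ e) (hr₀pos : 0 < r₀)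
    {good : ℕ → Prop} (hgood : ∀ ρ, good ρ → PairLTP p ρ r₀) {G₀ : PowerSeries K} (hk : PowerSeries.order G₀ = (1 : ℕ))
    {R₀ : MvPowerSeries (Fin 1) K} (hR₀ : ResIn (p ^ e) good R₀) {N : ℕ} {εs : ℕ → MvPowerSeries (Fin 1) K}
    (h0 : εs 0 = phiQ (p ^ e) (ppow_ne_zero p e) r₀ G₀ + R₀) (hrun : IsBottomRun p e ℓ εs N) {i₁ : ℕ}
    (hpre : ∀ i < i₁, ReducedRun.canonRun (p ^ (ℓ - e)) (ReducedRun.canonStepIIIq (p ^ (ℓ - e)) (p ^ e / r₀ + 1) G₀) i ≠ 0 ∧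
      (2 : ℕ∞) ≤ PowerSeries.order
        (ReducedRun.canonRun (p ^ (ℓ - e)) (ReducedRun.canonStepIIIq (p ^ (ℓ - e)) (p ^ e / r₀ + 1) G₀) i))
    (hesc : ReducedRun.canonRun (p ^ (ℓ - e)) (ReducedRun.canonStepIIIq (p ^ (ℓ - e)) (p ^ e / r₀ + 1) G₀) i₁ ≠ 0 ∧
      ((p ^ (ℓ - e) : ℕ) : ℕ∞) ≤ PowerSeries.order
        (ReducedRun.canonRun (p ^ (ℓ - e)) (ReducedRun.canonStepIIIq (p ^ (ℓ - e)) (p ^ e / r₀ + 1) G₀) i₁)) :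
    ∀ i, i + 1 ≤ N → i ≤ i₁ ∧ ∃ Ri : MvPowerSeries (Fin 1) K, ResIn (p ^ e) good Ri ∧
      εs (i + 1) = phiQ (p ^ e) (ppow_ne_zero p e) r₀
        (ReducedRun.canonRun (p ^ (ℓ - e)) (ReducedRun.canonStepIIIq (p ^ (ℓ - e)) (p ^ e / r₀ + 1) G₀) i) + Ri := by
  intro i hi
  obtain ⟨X, w, c, hX0, hsole, -, hw, hstep⟩ := hrun 0 (by omega)
  obtain ⟨R₁, hR₁, hE₁⟩ := stepAt_of_level_caseIIIP X h0 hr₀ hr₀pos hR₀ hgood he hle hX0 hk hsole hw c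
  have h1 : εs 1 = phiQ (p ^ e) (ppow_ne_zero p e) r₀ (ReducedRun.canonStepIIIq (p ^ (ℓ - e)) (p ^ e / r₀ + 1) G₀) + R₁ := by
    rw [hstep, hE₁]
  have hrun' : IsBottomRun p e ℓ (fun j => εs (j + 1)) i := fun j hj => hrun (j + 1) (by omega)
  exact run_of_level_of_escapeP he hle hr₀ hgood hR₁ h1 hrun' hpre hesc i le_rfl

/-- **An escape of the second state's run refutes box-confinement at bottom digit `1`** (`K` perfect; reference datum `X₀` of `F₀` with non-empty
top block, `α ≠ 0`, `q < ord F₀`; depth `ℓ ≥ ℓ₀`). [folklore] -/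
theorem not_staysInBox_of_escape_digitOneP [ExpChar K p] [PerfectRing K p] {e ℓ₀ ℓ : ℕ} (he : 0 < e) (hle₀ : e ≤ ℓ₀) (hℓ : ℓ₀ ≤ ℓ)
    {r₀ : ℕ} (hr₀ : r₀ < p ^ e) (hr₀pos : 0 < r₀) {good : ℕ → Prop} (hgood : ∀ ρ, good ρ → PairLTP p ρ r₀) {G₀ : PowerSeries K}
    (hk : PowerSeries.order G₀ = (1 : ℕ)) {F₀ R₀ : MvPowerSeries (Fin 1) K} (X₀ : StandardExpression p (xs K 1) e ℓ₀ F₀)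
    (hF₀ : F₀ = phiQ (p ^ e) (ppow_ne_zero p e) r₀ G₀ + R₀) (hR₀ : ResIn (p ^ e) good R₀)
    (h00 : 0 < frontierLength X₀.support X₀.u) (hα : alpha X₀.support X₀.u ≠ 0) (hord : ((p ^ e : ℕ) : ℕ∞) < adicOrder F₀)
    {i₁ : ℕ}
    (hpre : ∀ i < i₁, ReducedRun.canonRun (p ^ (ℓ - e)) (ReducedRun.canonStepIIIq (p ^ (ℓ - e)) (p ^ e / r₀ + 1) G₀) i ≠ 0 ∧
      (2 : ℕ∞) ≤ PowerSeries.order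
        (ReducedRun.canonRun (p ^ (ℓ - e)) (ReducedRun.canonStepIIIq (p ^ (ℓ - e)) (p ^ e / r₀ + 1) G₀) i))
    (hesc : ReducedRun.canonRun (p ^ (ℓ - e)) (ReducedRun.canonStepIIIq (p ^ (ℓ - e)) (p ^ e / r₀ + 1) G₀) i₁ ≠ 0 ∧
      ((p ^ (ℓ - e) : ℕ) : ℕ∞) ≤ PowerSeries.order
        (ReducedRun.canonRun (p ^ (ℓ - e)) (ReducedRun.canonStepIIIq (p ^ (ℓ - e)) (p ^ e / r₀ + 1) G₀) i₁)) :
    ¬ StaysInBox p e ℓ X₀ := by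
  intro hstay
  haveI : PerfectField K := PerfectRing.toPerfectField K p
  have hG₀ : G₀ ≠ 0 := fun h => by rw [h, PowerSeries.order_zero] at hk; exact ENat.top_ne_coe _ hk
  obtain ⟨N, εs, h0, hrun, hlow⟩ := exhausts_of_staysInBox X₀ he hle₀ h00 hα hord hℓ hstay
  have h0' : εs 0 = phiQ (p ^ e) (ppow_ne_zero p e) r₀ G₀ + R₀ := by rw [h0, hF₀]
  rcases N with _ | M
  · exact not_isLowerClass_of_levelP X₀ hF₀ hr₀ hR₀ hgood he hle₀ hG₀ h0' hR₀ hgood hG₀ hlow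
  · obtain ⟨hM, RM, hRM, hεM⟩ := run_of_level_of_escape_digitOneP he (le_trans hle₀ hℓ) hr₀ hr₀pos hgood hk hR₀ h0' hrun hpre hesc
      M le_rfl
    have hGM : ReducedRun.canonRun (p ^ (ℓ - e)) (ReducedRun.canonStepIIIq (p ^ (ℓ - e)) (p ^ e / r₀ + 1) G₀) M ≠ 0 := by
      rcases Nat.lt_or_ge M i₁ with h | h
      · exact (hpre M h).1
      · rw [le_antisymm hM h]; exact hesc.1
    exact not_isLowerClass_of_levelP X₀ hF₀ hr₀ hR₀ hgood he hle₀ hG₀ hεM hRM hgood hGM hlow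

/-- **Escapes of the second state `G₁ = univStepIIIq k̄ G₀` at every large `p`-power depth refute `Rescue.CarrierStaysInBox p e (Φ_{q,r₀} G₀)`**
(`ord G₀ = 1`, `G₀` supported below `B`; at depths `p^a > B` the canonical Case-(III) state IS `G₁`). [folklore] -/
theorem not_carrierStaysInBox_of_escapes_digitOneP [ExpChar K p] [PerfectRing K p] {e : ℕ} (he : 0 < e) {r₀ : ℕ} (hr₀ : r₀ < p ^ e)
    (hr₀p : r₀ % p ≠ 0) {G₀ : PowerSeries K} (hk : PowerSeries.order G₀ = (1 : ℕ)) {B : ℕ}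
    (hB : ∀ m, B < m → PowerSeries.coeff m G₀ = 0) {a₀ : ℕ}
    (hesc : ∀ a, a₀ ≤ a → ∃ i₁ : ℕ,
      (∀ i < i₁, ReducedRun.canonRun (p ^ a) (ReducedRun.univStepIIIq (p ^ e / r₀ + 1) G₀) i ≠ 0 ∧
        (2 : ℕ∞) ≤ PowerSeries.order (ReducedRun.canonRun (p ^ a) (ReducedRun.univStepIIIq (p ^ e / r₀ + 1) G₀) i)) ∧
      ReducedRun.canonRun (p ^ a) (ReducedRun.univStepIIIq (p ^ e / r₀ + 1) G₀) i₁ ≠ 0 ∧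
        ((p ^ a : ℕ) : ℕ∞) ≤ PowerSeries.order (ReducedRun.canonRun (p ^ a) (ReducedRun.univStepIIIq (p ^ e / r₀ + 1) G₀) i₁)) :
    ¬ Rescue.CarrierStaysInBox p e (phiQ (p ^ e) (ppow_ne_zero p e) r₀ G₀) := by
  intro h
  haveI : PerfectField K := PerfectRing.toPerfectField K p
  have hG₀ : G₀ ≠ 0 := fun h => by rw [h, PowerSeries.order_zero] at hk; exact ENat.top_ne_coe _ hk
  have hG₀0 : PowerSeries.constantCoeff G₀ = 0 := by
    rw [← PowerSeries.coeff_zero_eq_constantCoeff_apply]; exact (PowerSeries.order_eq_nat.mp hk).2 0 Nat.one_pos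
  have hr₀pos : 0 < r₀ := Nat.pos_of_ne_zero fun h0 => hr₀p (by rw [h0, Nat.zero_mod])
  have hF₀ : phiQ (p ^ e) (ppow_ne_zero p e) r₀ G₀ = phiQ (p ^ e) (ppow_ne_zero p e) r₀ G₀ + 0 := (add_zero _).symm
  set ℓ₀ := e + max a₀ (B + 1) with hℓ₀
  obtain ⟨X₀⟩ := nonempty_standardExpression_topFrame (p := p) K 1 e ℓ₀ (phiQ (p ^ e) (ppow_ne_zero p e) r₀ G₀)
  have hne : phiQ (p ^ e) (ppow_ne_zero p e) r₀ G₀ ≠ 0 := fun h0 => hG₀ ((phiQ_eq_zero_iff _ hr₀ G₀).mp h0)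
  have h00 : 0 < frontierLength X₀.support X₀.u := frontierLength_pos_of_ne_zero X₀ hne
  have hRin : ResIn (p ^ e) (fun ρ => PairLTP p ρ r₀) (0 : MvPowerSeries (Fin 1) K) := resIn_zero _
  obtain ⟨hαe, -⟩ := alpha_beta_of_levelP X₀ hF₀ hr₀ hRin (fun _ h => h) he (by omega) hG₀
  have hαne : alpha X₀.support X₀.u ≠ 0 := by rw [hαe]; exact Finsupp.single_ne_zero.mpr hr₀p
  have hord : ((p ^ e : ℕ) : ℕ∞) < adicOrder (phiQ (p ^ e) (ppow_ne_zero p e) r₀ G₀) := by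
    rw [adicOrder_eq_order]; exact lt_order_phiQ hr₀ hr₀pos hG₀0
  obtain ⟨ℓ, hℓ, hstay⟩ := h ℓ₀ X₀ he (by omega) h00 hαne hord
  obtain ⟨i₁, hpre, hne₁, hP⟩ := hesc (ℓ - e) (by omega)
  have hBP : B < p ^ (ℓ - e) :=
    lt_of_lt_of_le (Nat.lt_pow_self hp.out.one_lt) (Nat.pow_le_pow_right hp.out.pos (show B ≤ ℓ - e by omega))
  have hcanon : ReducedRun.canonStepIIIq (p ^ (ℓ - e)) (p ^ e / r₀ + 1) G₀ = ReducedRun.univStepIIIq (p ^ e / r₀ + 1) G₀ :=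
    ReducedRun.canonStepIIIq_eq_univStepIIIq fun m hm => hB m (by omega)
  refine not_staysInBox_of_escape_digitOneP he (by omega) hℓ hr₀ hr₀pos (fun _ h => h) hk X₀ hF₀ hRin h00 hαne hord
    (i₁ := i₁) ?_ ?_ hstay
  · rw [hcanon]; exact hpre
  · rw [hcanon]; exact ⟨hne₁, hP⟩

/-! ## §2 The twin-carrier equivalence at bottom digit `1` -/

/-- **THE TWIN-CARRIER EQUIVALENCE AT BOTTOM DIGIT `1`.** `K` of characteristic `p` with the premise binders, `0 < e`, `r₀ < q = p^e` with
`p ∤ r₀`, `ord G₀ = 1`, `G₀` supported below `B`, `G₁ := univStepIIIq (q / r₀ + 1) G₀`. Then `Rescue.CarrierStaysInBox p e (Φ_{q,r₀} G₀)` holds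
IF AND ONLY IF the canonical reduced run of `G₁` is EXHAUSTED IN BOX at infinitely many `p`-power depths. (←) `…PSlice`'s digit-one
confinement at a depth of exhaustion `> B`; (→) die-or-escape for `G₁` (`2 ≤ ord G₁`) and §1. OURS objects; nothing about the manuscript.
[folklore] -/
theorem carrierStaysInBox_phiQ_iff_digitOne [ExpChar K p] [PerfectRing K p] {e : ℕ} (he : 0 < e) {r₀ : ℕ} (hr₀ : r₀ < p ^ e)
    (hr₀p : r₀ % p ≠ 0) {G₀ : PowerSeries K} (hk : PowerSeries.order G₀ = (1 : ℕ)) {B : ℕ}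
    (hB : ∀ m, B < m → PowerSeries.coeff m G₀ = 0) :
    Rescue.CarrierStaysInBox p e (phiQ (p ^ e) (ppow_ne_zero p e) r₀ G₀) ↔
      ∀ a₀ : ℕ, ∃ a : ℕ, a₀ ≤ a ∧ ∃ i₁ : ℕ,
        (∀ i < i₁, ReducedRun.canonRun (p ^ a) (ReducedRun.univStepIIIq (p ^ e / r₀ + 1) G₀) i ≠ 0 ∧
          (2 : ℕ∞) ≤ PowerSeries.order (ReducedRun.canonRun (p ^ a) (ReducedRun.univStepIIIq (p ^ e / r₀ + 1) G₀) i) ∧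
          PowerSeries.order (ReducedRun.canonRun (p ^ a) (ReducedRun.univStepIIIq (p ^ e / r₀ + 1) G₀) i) < ((p ^ a : ℕ) : ℕ∞)) ∧
        ReducedRun.canonRun (p ^ a) (ReducedRun.univStepIIIq (p ^ e / r₀ + 1) G₀) i₁ = 0 := by
  have hG₀0 : PowerSeries.constantCoeff G₀ = 0 := by
    rw [← PowerSeries.coeff_zero_eq_constantCoeff_apply]; exact (PowerSeries.order_eq_nat.mp hk).2 0 Nat.one_pos
  have hr₀pos : 0 < r₀ := Nat.pos_of_ne_zero fun h0 => hr₀p (by rw [h0, Nat.zero_mod])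
  have h2 : (2 : ℕ∞) ≤ PowerSeries.order (ReducedRun.univStepIIIq (p ^ e / r₀ + 1) G₀) :=
    ReducedRun.two_le_order_univStepIIIq _ hG₀0
  have hF₀ : phiQ (p ^ e) (ppow_ne_zero p e) r₀ G₀ = phiQ (p ^ e) (ppow_ne_zero p e) r₀ G₀ + 0 := (add_zero _).symm
  have hRin : ResIn (p ^ e) (fun _ => False) (0 : MvPowerSeries (Fin 1) K) := resIn_zero _
  constructor
  · intro h
    by_contra hex
    push Not at hex
    obtain ⟨a₀, ha₀⟩ := hex
    refine not_carrierStaysInBox_of_escapes_digitOneP he hr₀ hr₀p hk hB (a₀ := a₀) (fun a ha => ?_) h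
    obtain ⟨i₁, hpre, hend⟩ := reduced_run_dichotomy (p := p) a h2
    rcases hend with hzero | ⟨hne, hP⟩
    · exact absurd hzero (ha₀ a ha i₁ hpre)
    · exact ⟨i₁, fun i hi => ⟨(hpre i hi).1, (hpre i hi).2.1⟩, hne, hP⟩
  · intro hex ℓ₀ X₀ _ hle h0 _ _
    obtain ⟨a, ha, i₁, hpre, hzero⟩ := hex (max ℓ₀ (B + 1))
    refine ⟨e + a, by omega, ?_⟩
    have hae : e + a - e = a := by omega
    have hBP : B < p ^ a := lt_of_lt_of_le (Nat.lt_pow_self hp.out.one_lt) (Nat.pow_le_pow_right hp.out.pos (show B ≤ a by omega))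
    have hcanon : ReducedRun.canonStepIIIq (p ^ (e + a - e)) (p ^ e / r₀ + 1) G₀ = ReducedRun.univStepIIIq (p ^ e / r₀ + 1) G₀ := by
      rw [hae]; exact ReducedRun.canonStepIIIq_eq_univStepIIIq fun m hm => hB m (by omega)
    refine staysInBox_of_level_of_reduced_exhaustion_digitOneP he (by omega) hr₀ hr₀pos (good := fun _ => False)
      (fun _ h => h.elim) hk X₀ hF₀ hRin hle (fun _ h => h.elim) (i₁ := i₁) ?_ ?_
    · intro i hi
      rw [hcanon, hae]
      exact hpre i hi
    · rw [hcanon, hae]; exact hzero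

end ReducedBridgeP

end CampaignW24

end Summit.ResolutionOfSingularities.ResolutionOfSingularities.Theorems

end
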